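import Literature.AnabelianGeometry.AbsoluteAnabelian.AbsTopI.RelativeGC
import Literature.AnabelianGeometry.AbsoluteAnabelian.AbsTopII.CuspidalizationChains
import HarnessLib

/-!
# [AbsTopII] §3 over a class `𝒟` of construction data: Corollaries 3.7, 3.8 in their printed
# generality (Profinite Belyi Cuspidalization I: Algorithms, II: Comparison)

S. Mochizuki, *Topics in Absolute Anabelian Geometry II: Decomposition Groups and Endomorphisms*
[AbsTopII], §3 pp. 72–74 (manuscript pagination, lit key `paper:url-585b8d0ad0d9`; bib key
`MochizukiAbsTopII2013`).  Sequel of `AbsTopII/BelyiCuspidalization.lean` (abc-iut-L4-t6, landed):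
there, Cor 3.7 / 3.8 are typed over `BelyiCurveModel` in the INSTANTIATED form of Remark 3.7.1
(`𝒟 :=` hyperbolic orbicurves × generalized sub-`p`-adic fields × (`Σ ∋ p`), [AbsTopI] Ex 4.8 (i)).
Here they are typed with their PRINTED hypotheses "let `𝒟` be a chain-full set of collections of
partial construction data such that the rel-isom-DGC holds" BY NAME, over abc-iut-L4-t13's
`AbsTopI.ConstructionDataClass` ([AbsTopI] Def 4.6: `IsChainFull`, `RelIsomDGC`), so that the
Belyi-cuspidalization link of the LC1 chain (`plan/L4/LC1-CHAIN.md` rows L1d → L2c) composes by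
name: the named fact `ConstructionDataClass.Ex_4_8_i` (its GC clause on curve members being
`Tpcs.Thm_4_12`, `relIsomGC_curves_of_thm_4_12`) ⟹ `IsChainFull ∧ RelIsomDGC` ⟹ the hypotheses of
`BelyiModel.Cor_3_7` / `Cor_3_8`; Remark 3.7.1 (= Rmk 3.3.1 for Cor 3.7) becomes the
LEMMAS `BelyiModel.cor_3_7_of_ex_4_8_i` / `cor_3_8_of_ex_4_8_i` (PROVED): for the class of
[AbsTopI] Ex 4.8 (i) every side hypothesis of Cor 3.7/3.8 — chain-fullness, rel-isom-DGC, "`G`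
slim", "`χ_l` has open image for some `l ∈ Σ`" (with `l := p`, also the COMMON `l` of Cor 3.8) — is
supplied by the named fact `ConstructionDataClass.Ex_4_8_i`.

## Typing (cell ruling θ, shape (M); no closed `∃` over a free "arises from")

* A member of `𝒟` over the construction-data field `k_b` is an object `X : (𝒟.datum b).Obj` with
  `𝒟.Mem b X`; its extension `(𝒟.datum b).ext X` = "`1 → Δ → Π → G → 1` of GSAFG-type with partial
  construction data `(k_b, X, Σ_b)`" has `G` LITERALLY `Gal(k̄_b/k_b)` (`absoluteGaloisGrp (𝒟.fld b)`)
  and `Π` the geometrically pro-`Σ_b` quotient of `π₁(X)` (abc-iut-L4-t13's datum), i.e. the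
  scheme-theoretic envelope `α` is an isomorphism on Galois groups, and for `Σ_b = Primes` (Cor 3.7:
  "`Σ` is the set of all primes [...] `α : π₁(X) ⥲ Π` [...] an isomorphism") an isomorphism.
  -- TODO(general form): GSAFG quotients `G = Gal(k̃/k)` with `k̃ ⊊ k̄` ([AbsTopI] Def 2.1 (iii)).
* The §3-specific scheme-side notions the datum does not carry — Def 3.5 "of strictly Belyi type",
  the cusps of `X`, "the nonempty open subschemes `U_X ⊆ X` defined over a number field" with their
  natural surjections `Π_{U_X} := π₁(U_X) ↠ π₁(X) ⥲ Π` and cusps — form the MODEL INTERFACE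
  `BelyiModel 𝒟` (no instance in the tree: the étale `π₁` is FOUNDATIONS row 12; a junk model
  falsifies only statements about itself).  `IsStrictlyBelyiType` is a primitive of the model; its
  PRINTED definition (NF-defined ∧ isogenous to a genus-`0` hyperbolic curve) is
  `AbsTopII.IsogenyModel.IsStrictlyBelyiType` (EllipticAdmissible.lean) over the isogeny-level model,
  and abc-iut-L4-t1's `AbsTopIII.CurveModel.IsStrictlyBelyiType` is the same primitive over the
  one-base-field model — three typings of one notion over the cell's three model interfaces
  (LC1-CHAIN F5/F6); no identification axiom is asserted anywhere.
* OUTPUT: the landed shape-(1) structures `BelyiCuspidalization E` / `Cuspidalization E`.  NEW here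
  (abc-iut-L4-t4's `PiChain`, [AbsTopI] Def 4.2 (iii), is in the tree since p406295): clause (a)
  "there exists a `Π`-chain [...] with associated type-chain `⋏, ⋎, •, …, •, ⋏, •, …, •, ⋎` that admits
  a terminal isomorphism with the trivial `Π`-chain" is typed for REAL (`HasTerminalChainOfType` of `AbsTopII/CuspidalizationChains.lean`: a `PiChain`
  with the given type-chain, a terminal isomorphism with the trivial chain, and second-to-last group
  `Π_V`) — this answers the content remark on `BelyiCurveModel.Cor_3_7` (audit B6-N1: `chainParams`
  unconstrained there).

* Also here, for the pro-`Σ` statements of the elliptic sequel: condition (3_Π) of [AbsTopI] Def 4.2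
  (iii) ("each `Δⱼ` is a pro-`Σ` group" — not a field of `PiChain`) as `IsProSigmaChain`, and the
  (3_Π)-restricted forms `HasProSigmaTerminalChainOfType`, `IsEtLocTerminalFor` of the chain predicates
  of `CuspidalizationChains.lean` (for `Σ` = all primes, as in Cor 3.7, (3_Π) is vacuous:
  `isProSigmaChain_univ`, `isEtLocTerminalFor_univ_iff`).

Deliberately NOT here: Cor 3.3 / 3.4 (elliptic; `AbsTopII/EllipticCuspidalizationComparison.lean`);
the recoverability prose of (a)/(b) beyond the data it names (recorded in the landed structures).
HONEST FRAMING: typed ≠ discharged; nothing here takes a side on [IUTchIII] Cor 3.12.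
-/

noncomputable section

open CategoryTheory Topology
open scoped Pointwise

universe u

namespace Literature.AnabelianGeometry.AbsoluteAnabelian.AbsTopII

open Literature.AlgebraicGeometry.Frobenioids (IsSlimGroup)
open FundamentalExtension
open AbsTopI (ConstructionDataClass)

/-! ### (3_Π): pro-`Σ` chains; `ÉtLoc`-terminality among them -/

section ProSigma

variable {E : FundamentalExtension.{u}} {CD : CuspidalData E} {hP : IsSlimGroup E.arith}
  {hΔ : IsSlimGroup E.geom} {hne : E.geom ≠ ⊥}

/-- Condition (3_Π) of [AbsTopI] Def 4.2 (iii) p. 49 for the construction-data prime set `Σ`: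
"Suppose that `X` is a hyperbolic orbicurve. Then each `Δⱼ` is a pro-`Σ` group" — not a field of
abc-iut-L4-t4's `PiChain` ("a consumer needing it adds the hypothesis `IsProSet L.geomJ Σ`",
`AbsTopIChains.lean`); vacuous for `Σ` = all primes (Cor 3.7), NOT for the pro-`Σ` Cor 3.3 / 3.4.
[cite: MochizukiAbsTopII2013, Cor 3.3 p.67] -/
def IsProSigmaChain (S : Set ℕ) (c : E.PiChain CD hP hΔ hne) : Prop :=
  ∀ j, IsProSet (c.term j).geomJ S

/-- For `Σ` = all primes condition (3_Π) is vacuous. [cite: MochizukiAbsTopII2013, Cor 3.7 p.72] -/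
theorem isProSigmaChain_univ (c : E.PiChain CD hP hΔ hne) : IsProSigmaChain Set.univ c :=
  fun _ => ⟨fun _ _ _ _ _ _ => Set.mem_univ _⟩

/-- `HasTerminalChainOfType` (CuspidalizationChains.lean) with the witnessing chain subject to (3_Π)
for `Σ`: "there exists a `Π`-chain [each `Δⱼ` pro-`Σ`] with associated type-chain `τ` that admits a
terminal isomorphism with the trivial `Π`-chain", second-to-last group `Π_V = P`.
[cite: MochizukiAbsTopII2013, Cor 3.3 (iii)(a) p.68] -/
def HasProSigmaTerminalChainOfType (S : Set ℕ) (CD : CuspidalData E) (hP : IsSlimGroup E.arith)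
    (hΔ : IsSlimGroup E.geom) (hne : E.geom ≠ ⊥) (τ : List ElementaryOp) (P : Subgroup E.arith) :
    Prop :=
  ∃ c : E.PiChain CD hP hΔ hne, IsProSigmaChain S c ∧
    c.typeChain = τ.map ElementaryOp.toElemOpType ∧
      c.HasTerminalIso (trivialChain CD hP hΔ hne) ∧
      ∃ (j : Fin (c.len + 1)) (_ : j.val + 1 = c.len) (e : ↥P ≃ₜ* (c.term j).grp) (g : E.gal),
        ∀ x : P, (c.term j).proj (e x) = MulAut.conj g (E.aug x)

/-- The pro-`Σ` version implies the unrestricted one. [cite: MochizukiAbsTopII2013, Cor 3.3 (iii)(a) p.68] -/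
theorem HasProSigmaTerminalChainOfType.hasTerminalChainOfType {S : Set ℕ} {τ : List ElementaryOp}
    {P : Subgroup E.arith} (h : HasProSigmaTerminalChainOfType S CD hP hΔ hne τ P) :
    HasTerminalChainOfType CD hP hΔ hne τ P := by
  obtain ⟨c, -, h₁, h₂, h₃⟩ := h
  exact ⟨c, h₁, h₂, h₃⟩

/-- `IsEtLocTerminal` (CuspidalizationChains.lean) with the objects of `ÉtLoc(Π)` subject to (3_Π)
for `Σ` — the reading of "terminal object of `ÉtLoc(Π)`" used for the pro-`Σ` Cor 3.3 (i): every
pro-`Σ` chain of `⋏`'s and `⋎`'s admits an injective terminal homomorphism to `c`, unique up to an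
inner automorphism of the target (see the module docstring; -- TODO(reading)).
[cite: MochizukiAbsTopII2013, Cor 3.3 (i) p.68] -/
def IsEtLocTerminalFor (S : Set ℕ) (c : E.PiChain CD hP hΔ hne) : Prop :=
  ∀ c' : E.PiChain CD hP hΔ hne, c'.IsEtLocObj → IsProSigmaChain S c' →
    (∃ (φ : c'.last.grp →ₜ* c.last.grp) (g : E.gal), Function.Injective φ ∧ IsOpen (Set.range φ) ∧
        ∀ x, c.last.proj (φ x) = MulAut.conj g (c'.last.proj x)) ∧
      ∀ (φ φ' : c'.last.grp →ₜ* c.last.grp) (g g' : E.gal),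
        Function.Injective φ → IsOpen (Set.range φ) →
        (∀ x, c.last.proj (φ x) = MulAut.conj g (c'.last.proj x)) →
        Function.Injective φ' → IsOpen (Set.range φ') →
        (∀ x, c.last.proj (φ' x) = MulAut.conj g' (c'.last.proj x)) →
          ∃ t : c.last.grp, ∀ x, φ' x = t * φ x * t⁻¹

/-- For `Σ` = all primes the restricted notion is the unrestricted `IsEtLocTerminal`.
[cite: MochizukiAbsTopII2013, Cor 3.3 (i) p.68] -/
theorem isEtLocTerminalFor_univ_iff (c : E.PiChain CD hP hΔ hne) :
    IsEtLocTerminalFor Set.univ c ↔ IsEtLocTerminal c :=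
  ⟨fun h c' hc' => h c' hc' (isProSigmaChain_univ c'), fun h c' hc' _ => h c' hc'⟩

end ProSigma

/-! ### The model interface over a class `𝒟` of construction data -/

variable {𝒟 : ConstructionDataClass.{u}}

/-- MODEL INTERFACE (shape (M); no instance in the tree) for Cor 3.7 / 3.8 over a class `𝒟` of
construction data ([AbsTopI] Def 4.6 (i), abc-iut-L4-t13's `ConstructionDataClass`): for each member
`X` over `k_b` — with `(𝒟.datum b).ext X` = "`1 → Δ → Π → G → 1`", `G = Gal(k̄_b/k_b)` — the cusps
of `X` (cuspidal decomposition groups in `Π`, [AbsTopI] Lemma 4.5 (v)), the predicate "`X` is of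
strictly Belyi type" (Def 3.5 p. 71), and "for every nonempty open subscheme `U_X ⊆ X` defined over a
number field, the natural surjection `Π_{U_X} := π₁(U_X) ↠ π₁(X) ⥲ Π`" (Cor 3.7 p. 73) with the
cusps of `U_X`. [cite: MochizukiAbsTopII2013, Cor 3.7 p.73] -/
structure BelyiModel (𝒟 : ConstructionDataClass.{u}) : Type (u + 1) where
  /-- the cusps of the member `X`, with their decomposition groups in `Π` -/
  cusps : ∀ (b : 𝒟.Base) (X : (𝒟.datum b).Obj), CuspidalData ((𝒟.datum b).ext X)
  /-- Def 3.5: "`X` is of strictly Belyi type" -/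
  IsStrictlyBelyiType : ∀ b : 𝒟.Base, (𝒟.datum b).Obj → Prop
  /-- the nonempty open subschemes `U_X ⊆ X` defined over a number field -/
  NFOpen : ∀ b : 𝒟.Base, (𝒟.datum b).Obj → Type u
  /-- "the natural surjection `Π_{U_X} := π₁(U_X) ↠ π₁(X) ⥲ Π`" -/
  cuspOf : ∀ {b : 𝒟.Base} {X : (𝒟.datum b).Obj}, NFOpen b X → Cuspidalization ((𝒟.datum b).ext X)
  /-- the cusps of `U_X`, with their decomposition groups in `Π_{U_X}` -/
  cuspsOf : ∀ {b : 𝒟.Base} {X : (𝒟.datum b).Obj} (U : NFOpen b X), CuspidalData (cuspOf U).ext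

namespace BelyiModel

variable (M : BelyiModel 𝒟)

/-- The STANDING HYPOTHESES of Cor 3.7 p. 72 on one member (everything except the `𝒟`-hypotheses
"chain-full, rel-isom-DGC"): "`G` a slim profinite group; `1 → Δ → Π → G → 1` an extension of
GSAFG-type [⇒ `Δ` slim, [AbsTopI] Def 2.1 (iii); `Δ ≠ 1` for a hyperbolic orbicurve] that admits
partial construction data `(k, X, Σ)`, where `k` is of characteristic zero, `X` is a hyperbolic
orbicurve of strictly Belyi type, and `Σ` is the set of all primes, such that `([X],[k],Σ) ∈ 𝒟`;
`α : π₁(X) ⥲ Π` [...] an isomorphism [built into the datum]. Suppose further that, for some `l ∈ Σ`,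
the cyclotomic character `G → ℤ_l^×` has open image." [cite: MochizukiAbsTopII2013, Cor 3.7 p.72] -/
structure IsCor37Member (b : 𝒟.Base) (X : (𝒟.datum b).Obj) : Prop where
  /-- `([X],[k_b],Σ_b) ∈ 𝒟` -/
  mem : 𝒟.Mem b X
  /-- "`Σ` is the set of all primes" -/
  primes_eq : (𝒟.datum b).primes = Set.univ
  /-- "`X` is a hyperbolic orbicurve of strictly Belyi type" -/
  strictlyBelyi : M.IsStrictlyBelyiType b X
  /-- "`G` a slim profinite group" (`G = Gal(k̄_b/k_b)`) -/
  slim : IsSlimGroup ((𝒟.datum b).ext X).gal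
  /-- "for some `l ∈ Σ`, the cyclotomic character `G → ℤ_l^×` has open image" -/
  cyclotomic : ∃ (l : ℕ) (_ : Fact l.Prime), IsOpen (Set.range (AbsTopIII.cyclotomicChar (𝒟.fld b) l))
  /-- GSAFG-type: `Δ` is slim ([AbsTopI] Def 2.1 (iii)) -/
  geom_slim : IsSlimGroup ((𝒟.datum b).ext X).geom
  /-- `X` a hyperbolic orbicurve: `Δ ≠ 1` ([AbsTopI] Def 4.2 (iii) (2_Π)) -/
  geom_ne_bot : ((𝒟.datum b).ext X).geom ≠ ⊥

/-- Under the standing hypotheses `Π` itself is slim ([AbsAnab] Lemma 1.3.1: "a formal consequence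
of the slimness of `Δ_X` and [...] `G_K`" — abc-iut-L4-t4's PROVED
`arith_slim_of_geom_slim_of_gal_slim`), so that `Π`-chains of `Π` make sense.
[cite: MochizukiAbsTopII2013, Cor 3.7 p.72] -/
theorem IsCor37Member.arith_slim {M : BelyiModel 𝒟} {b : 𝒟.Base} {X : (𝒟.datum b).Obj}
    (h : M.IsCor37Member b X) : IsSlimGroup ((𝒟.datum b).ext X).arith :=
  ((𝒟.datum b).ext X).arith_slim_of_geom_slim_of_gal_slim h.geom_slim h.slim

/-! ### Corollary 3.7 (Profinite Belyi Cuspidalization I: Algorithms), printed generality -/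

/-- **Corollary 3.7** pp. 72–73 relative to `(𝒟, M)` (shape (M)): "Let `𝒟` be a chain-full set of
collections of partial construction data such that the rel-isom-DGC holds [cf. [AbsTopI] Def 4.6
(i), (ii)]" and `X` a member satisfying the standing hypotheses (`IsCor37Member`).  "Then for every
nonempty open subscheme `U_X ⊆ X` defined over a number field, the natural surjection
`Π_{U_X} := π₁(U_X) ↠ π₁(X) ⥲ Π` — i.e., 'cuspidalization' of `Π` — may be constructed via
'group-theoretic' operations as follows: (a) [...] there exists a `Π`-chain [...] with associated
type-chain `⋏, ⋎, •, …, •, ⋏, •, …, •, ⋎` that admits a terminal isomorphism with the trivial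
`Π`-chain [...]; (b) `Π_{U_X} ↠ Π` may be recovered from `Π_U ↠ Π_V` by forming the `⋊^out` [...];
(c) the decomposition groups of the closed points of `X` lying in the complement of `U_X` [are] the
images via `Π_{U_X} ↠ Π` of the cuspidal decomposition groups".  TYPED: some
`BelyiCuspidalization` of `Π ↠ G` has output isomorphic over `Π` to the model's `π₁(U_X) ↠ Π`, the
same images of cuspidal decomposition groups, AND its type-chain / `Π_V` are those of a genuine
`Π`-chain with a terminal isomorphism to the trivial chain (`HasTerminalChainOfType`).  The
remaining prose of (a)/(b) ("may be recovered from") is carried by the fields of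
`BelyiCuspidalization` (`projU`, `glue`, `lifting_unique`, `center_PiU_eq_bot`).
[cite: MochizukiAbsTopII2013, Cor 3.7 pp.72-73] -/
def Cor_3_7 : Prop :=
  𝒟.IsChainFull → 𝒟.RelIsomDGC →
    ∀ (b : 𝒟.Base) (X : (𝒟.datum b).Obj) (h : M.IsCor37Member b X) (U : M.NFOpen b X),
      ∃ B : BelyiCuspidalization ((𝒟.datum b).ext X),
        B.cusp.IsoOver (M.cuspOf U) ∧
          B.cusp.decompositionImages B.cusps = (M.cuspOf U).decompositionImages (M.cuspsOf U) ∧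
          HasTerminalChainOfType (M.cusps b X) h.arith_slim h.geom_slim h.geom_ne_bot
            B.typeChain B.PiV

/-! ### Corollary 3.8 (Profinite Belyi Cuspidalization II: Comparison), printed generality -/

/-- **Corollary 3.8** p. 74 relative to `(𝒟, M)` (shape (M)): "Let `𝒟` be a chain-full set of
collections of partial construction data such that the rel-isom-DGC holds.  For `i = 1, 2`, let
[`Xᵢ` over `kᵢ` be members satisfying the standing hypotheses, `Σᵢ` = all primes].  Suppose further
that, for some `l ∈ Σ₁ ∩ Σ₂`, the cyclotomic characters `Gᵢ → ℤ_l^×` have open image for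
`i = 1, 2` [ONE COMMON `l`].  Let `φ : Π₁ ⥲ Π₂` be an isomorphism of profinite groups such that
`φ(Δ₁) = Δ₂`.  Then, for each nonempty open subscheme `U_{X₁} ⊆ X₁` defined over a number field,
there exist a nonempty open subscheme `U_{X₂} ⊆ X₂` defined over a number field and an isomorphism
of profinite groups `φ_U : Π_{U_{X₁}} ⥲ Π_{U_{X₂}}` that is compatible with `φ`, relative to the
natural surjections `Π_{U_{Xᵢ}} ↠ Πᵢ`.  Moreover, such an isomorphism `φ_U` is unique up to
composition with an inner automorphism arising from an element of the kernel of `Π_{U_{Xᵢ}} ↠ Πᵢ`."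
The two members may lie over DIFFERENT construction-data fields `k_{b₁}`, `k_{b₂}`.
[cite: MochizukiAbsTopII2013, Cor 3.8 p.74] -/
def Cor_3_8 : Prop :=
  𝒟.IsChainFull → 𝒟.RelIsomDGC →
    ∀ (b₁ b₂ : 𝒟.Base) (X₁ : (𝒟.datum b₁).Obj) (X₂ : (𝒟.datum b₂).Obj),
      M.IsCor37Member b₁ X₁ → M.IsCor37Member b₂ X₂ →
      (∃ (l : ℕ) (_ : Fact l.Prime), IsOpen (Set.range (AbsTopIII.cyclotomicChar (𝒟.fld b₁) l)) ∧
        IsOpen (Set.range (AbsTopIII.cyclotomicChar (𝒟.fld b₂) l))) →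
      ∀ φ : ((𝒟.datum b₁).ext X₁).arith ≃ₜ* ((𝒟.datum b₂).ext X₂).arith,
        ((𝒟.datum b₁).ext X₁).geom.map φ.toMonoidHom = ((𝒟.datum b₂).ext X₂).geom →
        ∀ U₁ : M.NFOpen b₁ X₁, ∃ U₂ : M.NFOpen b₂ X₂,
          (∃ φU : (M.cuspOf U₁).ext.arith ≃ₜ* (M.cuspOf U₂).ext.arith,
              ∀ x, (M.cuspOf U₂).hom.arith (φU x) = φ ((M.cuspOf U₁).hom.arith x)) ∧
          ∀ φU φU' : (M.cuspOf U₁).ext.arith ≃ₜ* (M.cuspOf U₂).ext.arith,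
            (∀ x, (M.cuspOf U₂).hom.arith (φU x) = φ ((M.cuspOf U₁).hom.arith x)) →
            (∀ x, (M.cuspOf U₂).hom.arith (φU' x) = φ ((M.cuspOf U₁).hom.arith x)) →
              ∃ g : (M.cuspOf U₂).ext.arith, (M.cuspOf U₂).hom.arith g = 1 ∧
                ∀ x, φU' x = g * φU x * g⁻¹

/-- Cor 3.8 for `φ = id` on ONE member gives, for each `U₁`, some `U₂` with isomorphic
cuspidalization (`U₂ = U₁` qualifies in the intended model; sanity consequence, PROVED from
`Cor_3_8`). [cite: MochizukiAbsTopII2013, Cor 3.8 p.74] -/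
theorem Cor_3_8.self_iso {M : BelyiModel 𝒟} (h : M.Cor_3_8) (hfull : 𝒟.IsChainFull)
    (hGC : 𝒟.RelIsomDGC) {b : 𝒟.Base} {X : (𝒟.datum b).Obj} (hX : M.IsCor37Member b X)
    (U₁ : M.NFOpen b X) : ∃ U₂ : M.NFOpen b X, (M.cuspOf U₁).IsoOver (M.cuspOf U₂) := by
  obtain ⟨l, hl, hopen⟩ := hX.cyclotomic
  obtain ⟨U₂, ⟨φU, hφU⟩, -⟩ := h hfull hGC b b X X hX hX ⟨l, hl, hopen, hopen⟩
    (ContinuousMulEquiv.refl _) (by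
      ext x
      simp only [Subgroup.mem_map]
      constructor
      · rintro ⟨y, hy, rfl⟩; exact hy
      · exact fun hx => ⟨x, hx, rfl⟩) U₁
  exact ⟨U₂, φU, fun x => hφU x⟩

/-! ### Remark 3.7.1 (= Remarks 3.3.1–3.3.3 for Cor 3.7): the `𝒟` of [AbsTopI] Example 4.8 (i) -/

/-- **Remark 3.7.1** p. 73 with Remark 3.3.1 p. 69, as a LEMMA: "if one takes `𝔽` to be the set of
isomorphism classes of generalized sub-`p`-adic fields, `𝕊` the set of sets of prime numbers
containing `p`, and `𝕍` [...] hyperbolic orbicurves [...], then `𝒟 := 𝕍 × 𝔽 × 𝕊` satisfies the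
hypothesis of Corollary 3.3 [resp. 3.7] concerning '`𝒟`' [cf. [AbsTopI] Example 4.8 (i)]" — and
Example 4.8 (i) supplies ALSO "`G` slim" ([Tpcs] Lem 4.14) and "`p` serves as the prime `l`" (`χ_p`
open): for such a class (abc-iut-L4-t13's `IsEx48ClassGen p` with the named fact `Ex_4_8_i p`) a
member with `Σ = Primes` of strictly Belyi type with slim nontrivial `Δ` satisfies every standing
hypothesis of Cor 3.7. [cite: MochizukiAbsTopII2013, Rmk 3.7.1 p.73] -/
theorem isCor37Member_of_ex_4_8_i {p : ℕ} [Fact p.Prime] (h𝒟 : 𝒟.IsEx48ClassGen p)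
    (hEx : 𝒟.Ex_4_8_i p) {b : 𝒟.Base} {X : (𝒟.datum b).Obj} (hmem : 𝒟.Mem b X)
    (hprimes : (𝒟.datum b).primes = Set.univ) (hB : M.IsStrictlyBelyiType b X)
    (hΔ : IsSlimGroup ((𝒟.datum b).ext X).geom) (hne : ((𝒟.datum b).ext X).geom ≠ ⊥) :
    M.IsCor37Member b X where
  mem := hmem
  primes_eq := hprimes
  strictlyBelyi := hB
  slim := (hEx h𝒟).2.2.2 b
  cyclotomic := ⟨p, inferInstance, (hEx h𝒟).2.2.1 b⟩
  geom_slim := hΔ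
  geom_ne_bot := hne

/-- **Cor 3.7 with Rmk 3.7.1** (PROVED reduction): over the class of [AbsTopI] Ex 4.8 (i), given the
named fact `Ex_4_8_i` and `Cor_3_7`, the conclusion of Cor 3.7 holds for every member with
`Σ = Primes` of strictly Belyi type (with slim nontrivial `Δ`) and every NF-rational open `U_X` —
no `𝒟`-hypothesis, slimness of `G` or cyclotomic hypothesis remains.
[cite: MochizukiAbsTopII2013, Rmk 3.7.1 p.73] -/
theorem cor_3_7_of_ex_4_8_i {p : ℕ} [Fact p.Prime] (h𝒟 : 𝒟.IsEx48ClassGen p)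
    (hEx : 𝒟.Ex_4_8_i p) (h37 : M.Cor_3_7) {b : 𝒟.Base} {X : (𝒟.datum b).Obj}
    (hmem : 𝒟.Mem b X) (hprimes : (𝒟.datum b).primes = Set.univ) (hB : M.IsStrictlyBelyiType b X)
    (hΔ : IsSlimGroup ((𝒟.datum b).ext X).geom) (hne : ((𝒟.datum b).ext X).geom ≠ ⊥)
    (U : M.NFOpen b X) :
    ∃ B : BelyiCuspidalization ((𝒟.datum b).ext X),
      B.cusp.IsoOver (M.cuspOf U) ∧
        B.cusp.decompositionImages B.cusps = (M.cuspOf U).decompositionImages (M.cuspsOf U) ∧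
        HasTerminalChainOfType (M.cusps b X)
          (M.isCor37Member_of_ex_4_8_i h𝒟 hEx hmem hprimes hB hΔ hne).arith_slim hΔ hne
          B.typeChain B.PiV :=
  h37 (hEx h𝒟).1 (hEx h𝒟).2.1 b X (M.isCor37Member_of_ex_4_8_i h𝒟 hEx hmem hprimes hB hΔ hne) U

/-- **Cor 3.8 with Rmk 3.7.1 / 3.8.1's situation** (PROVED reduction): over the class of [AbsTopI]
Ex 4.8 (i) the common prime `l` of Cor 3.8 is `l := p` (Ex 4.8 (i): "the prime `p` clearly serves as
a prime `l`", for EVERY construction-data field of the class), so the comparison statement holds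
for any two members with `Σ = Primes` of strictly Belyi type, given `Ex_4_8_i` and `Cor_3_8`.
[cite: MochizukiAbsTopII2013, Cor 3.8 p.74] -/
theorem cor_3_8_of_ex_4_8_i {p : ℕ} [Fact p.Prime] (h𝒟 : 𝒟.IsEx48ClassGen p)
    (hEx : 𝒟.Ex_4_8_i p) (h38 : M.Cor_3_8) {b₁ b₂ : 𝒟.Base} {X₁ : (𝒟.datum b₁).Obj}
    {X₂ : (𝒟.datum b₂).Obj} (hmem₁ : 𝒟.Mem b₁ X₁) (hmem₂ : 𝒟.Mem b₂ X₂)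
    (hprimes₁ : (𝒟.datum b₁).primes = Set.univ) (hprimes₂ : (𝒟.datum b₂).primes = Set.univ)
    (hB₁ : M.IsStrictlyBelyiType b₁ X₁) (hB₂ : M.IsStrictlyBelyiType b₂ X₂)
    (hΔ₁ : IsSlimGroup ((𝒟.datum b₁).ext X₁).geom) (hne₁ : ((𝒟.datum b₁).ext X₁).geom ≠ ⊥)
    (hΔ₂ : IsSlimGroup ((𝒟.datum b₂).ext X₂).geom) (hne₂ : ((𝒟.datum b₂).ext X₂).geom ≠ ⊥)
    (φ : ((𝒟.datum b₁).ext X₁).arith ≃ₜ* ((𝒟.datum b₂).ext X₂).arith)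
    (hφ : ((𝒟.datum b₁).ext X₁).geom.map φ.toMonoidHom = ((𝒟.datum b₂).ext X₂).geom)
    (U₁ : M.NFOpen b₁ X₁) :
    ∃ U₂ : M.NFOpen b₂ X₂,
      (∃ φU : (M.cuspOf U₁).ext.arith ≃ₜ* (M.cuspOf U₂).ext.arith,
          ∀ x, (M.cuspOf U₂).hom.arith (φU x) = φ ((M.cuspOf U₁).hom.arith x)) ∧
      ∀ φU φU' : (M.cuspOf U₁).ext.arith ≃ₜ* (M.cuspOf U₂).ext.arith,
        (∀ x, (M.cuspOf U₂).hom.arith (φU x) = φ ((M.cuspOf U₁).hom.arith x)) →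
        (∀ x, (M.cuspOf U₂).hom.arith (φU' x) = φ ((M.cuspOf U₁).hom.arith x)) →
          ∃ g : (M.cuspOf U₂).ext.arith, (M.cuspOf U₂).hom.arith g = 1 ∧
            ∀ x, φU' x = g * φU x * g⁻¹ :=
  h38 (hEx h𝒟).1 (hEx h𝒟).2.1 b₁ b₂ X₁ X₂
    (M.isCor37Member_of_ex_4_8_i h𝒟 hEx hmem₁ hprimes₁ hB₁ hΔ₁ hne₁)
    (M.isCor37Member_of_ex_4_8_i h𝒟 hEx hmem₂ hprimes₂ hB₂ hΔ₂ hne₂)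
    ⟨p, inferInstance, (hEx h𝒟).2.2.1 b₁, (hEx h𝒟).2.2.1 b₂⟩ φ hφ U₁

end BelyiModel

/-! ### Remark 3.8.1 (p. 74) — recorded, no claim typed
`Rmk_3_8_1 : recorded.`  "A similar remark to Remark 3.4.1 may be made for Corollary 3.8", i.e. a
tempered version when the base fields are MLF's ([AbsTopI] Thm 4.12); as for Rmk 3.3.3 / 3.4.1 the
tempered statements have the same shape over the tempered-`π₁` interface of abc-iut-L3-t2 and no
further claim is printed. [cite: MochizukiAbsTopII2013, Rmk 3.8.1 p.74] -/

end Literature.AnabelianGeometry.AbsoluteAnabelian.AbsTopII
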